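import Summits.QuantumFields.YangMills.Theorems.ComplexCouplingChannelHarmonicMeasureEngineTorusLegPrelims

/-!
# Floor at the centre + envelope on a ball ⇒ zero-free two-sided window on a smaller ball

Helper file for the crux `FreeEnergyWindowChannel` (item `stmt-QuantumFields-18842`, route `ComplexCouplingChannel`
of `QuantumFields/YangMills`), line `Sketch`, stub S5 (`stub_localWindowOfEnvelope`).  Pure one-variable complex
analysis: the LOCAL converter from the one-sided envelope bound to a zero-free two-sided window.

For a family `Z P : ℂ → ℂ` (`P : ℕ`) holomorphic on `ball t δ` (`t` real), `f` holomorphic there, and, for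
`P ≥ P₀`, the FLOOR `Z P t ≠ 0`, `log ‖Z P t‖ + P⁴ Re f t ≥ −M` at the centre and the ENVELOPE
`‖Z P z · exp (P⁴ f z)‖ ≤ e^M` on the ball, we get `0 < δ' ≤ δ` and `M'` (independent of `P`) with
`Z P z ≠ 0` and `|log ‖Z P z‖ + P⁴ Re f z| ≤ M'` for `P ≥ P₀`, `z ∈ ball t δ'`.

Proof.  WLOG `M ≥ 0`.  `G_P := Z P · exp (P⁴ f)` is holomorphic on the ball with `‖G_P‖ ≤ e^M` and
`‖G_P t‖ ≥ e^{−M}`.  (1) ZERO-FREE: if `G_P w = 0` with `|w − t| < δ/4`, the Schwarz lemma for `G_P` on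
`ball w (δ/2) ⊆ ball t δ` (Mathlib `Complex.dist_le_div_mul_dist_of_mapsTo_ball`, target `closedBall 0 e^M`) gives
`‖G_P t‖ ≤ (2 e^M / δ) |t − w|`, so `|w − t| ≥ δ e^{−2M}/2`; hence `G_P` is zero-free on `ball t (δ e^{−2M}/4)`,
uniformly in `P`.  (2) TWO-SIDED BOUND: on that ball `W := G_P (t + ·)/G_P t` is holomorphic, zero-free, `W 0 = 1`,
so `W = exp ∘ g` with `g 0 = 0` (tree `exists_differentiableOn_exp_eq`), `Re g = log ‖G_P (t + ·)‖ − log ‖G_P t‖ ≤ 2M`,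
and Borel–Carathéodory (tree `norm_le_of_re_le_of_norm_zero_le`) bounds `‖g‖ ≤ 5 (2M + 1)` on the half ball; so
`|log ‖G_P z‖| ≤ 11 M + 5` for `|z − t| < δ e^{−2M}/8`, and `log ‖G_P z‖ = log ‖Z P z‖ + P⁴ Re f z`.

References: preliminaries in `ComplexCouplingChannelHarmonicMeasureEngineTorusLegPrelims.lean`
(`exists_differentiableOn_exp_eq`, `norm_le_of_re_le_of_norm_zero_le`); Mathlib
`Complex.dist_le_div_mul_dist_of_mapsTo_ball` (Schwarz lemma).
-/

open Complex Metric Set Filter Topology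

namespace Summit.QuantumFields.YangMills.Theorems.FreeEnergyWindowChannel

open Summit.QuantumFields.YangMills.Theorems.ComplexCouplingChannel

/-- `‖a · exp (P⁴ b)‖ = exp (log ‖a‖ + P⁴ Re b)` for `a ≠ 0`. [folklore] -/
theorem norm_mul_cexp_pow_four_mul_eq {a b : ℂ} (ha : a ≠ 0) {P : ℕ} :
    ‖a * Complex.exp ((P : ℂ) ^ 4 * b)‖ = Real.exp (Real.log ‖a‖ + (P : ℝ) ^ 4 * b.re) := by
  have hP : ((P : ℂ) ^ 4) = (((P : ℝ) ^ 4 : ℝ) : ℂ) := by push_cast; rfl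
  rw [norm_mul, Complex.norm_exp, Real.exp_add, Real.exp_log (norm_pos_iff.2 ha), hP, Complex.re_ofReal_mul]

/-- **A zero near the centre makes the centre value small** (Schwarz lemma).  If `G` is holomorphic on
`ball c δ` with `‖G‖ ≤ B` there and `G w = 0` for some `w` with `dist w c < δ/4`, then
`‖G c‖ ≤ (B / (δ/2)) · dist c w`. [folklore] -/
theorem norm_center_le_of_eq_zero {G : ℂ → ℂ} {c w : ℂ} {δ B : ℝ}
    (hG : DifferentiableOn ℂ G (ball c δ)) (hB : ∀ z ∈ ball c δ, ‖G z‖ ≤ B)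
    (hw : dist w c < δ / 4) (hGw : G w = 0) : ‖G c‖ ≤ B / (δ / 2) * dist c w := by
  have hδ : 0 < δ := by linarith [dist_nonneg (x := w) (y := c)]
  have hsub : ball w (δ / 2) ⊆ ball c δ := by
    intro z hz
    rw [mem_ball] at hz ⊢
    calc dist z c ≤ dist z w + dist w c := dist_triangle z w c
      _ < δ / 2 + δ / 4 := add_lt_add hz hw
      _ ≤ δ := by linarith
  have hmaps : MapsTo G (ball w (δ / 2)) (closedBall (G w) B) := by
    intro z hz
    rw [mem_closedBall, hGw, dist_zero_right]
    exact hB z (hsub hz)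
  have hc : c ∈ ball w (δ / 2) := by
    rw [mem_ball, dist_comm]
    linarith
  have h := Complex.dist_le_div_mul_dist_of_mapsTo_ball (hG.mono hsub) hmaps hc
  rwa [hGw, dist_zero_right] at h

/-- **Two-sided bound from a one-sided bound, zero-freeness and a floor at the centre** (Borel–Carathéodory for
the holomorphic logarithm).  If `G` is holomorphic and zero-free on `ball c r` with `‖G‖ ≤ e^A` there (`A ≥ 0`)
and `‖G c‖ ≥ e^{−A}`, then `|log ‖G z‖| ≤ 11 A + 5` on `ball c (r/2)`. [folklore] -/
theorem abs_log_norm_le_of_norm_le_of_ne_zero {G : ℂ → ℂ} {c : ℂ} {r A : ℝ} (hr : 0 < r) (hA : 0 ≤ A)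
    (hG : DifferentiableOn ℂ G (ball c r)) (hG0 : ∀ z ∈ ball c r, G z ≠ 0)
    (hup : ∀ z ∈ ball c r, ‖G z‖ ≤ Real.exp A) (hlow : Real.exp (-A) ≤ ‖G c‖) :
    ∀ z ∈ ball c (r / 2), |Real.log ‖G z‖| ≤ 11 * A + 5 := by
  have hc : c ∈ ball c r := mem_ball_self hr
  have hGc : G c ≠ 0 := hG0 c hc
  have hGc' : 0 < ‖G c‖ := norm_pos_iff.2 hGc
  have hsh : ∀ z ∈ ball (0 : ℂ) r, c + z ∈ ball c r := by
    intro z hz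
    rw [mem_ball, dist_eq_norm, add_sub_cancel_left]
    exact mem_ball_zero_iff.1 hz
  -- the normalised shifted function and its holomorphic logarithm
  set W : ℂ → ℂ := fun z => G (c + z) / G c with hW_def
  have hWd : DifferentiableOn ℂ W (ball 0 r) :=
    (hG.comp (differentiableOn_id.const_add c) hsh).div_const _
  have hW0 : ∀ z ∈ ball (0 : ℂ) r, W z ≠ 0 := fun z hz => div_ne_zero (hG0 _ (hsh z hz)) hGc
  have hW1 : W 0 = 1 := by simp [hW_def, hGc]
  obtain ⟨g, hgd, hg0, hexp⟩ := exists_differentiableOn_exp_eq hr hWd hW0 hW1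
  -- logarithms of the bounds
  have hlogc : -A ≤ Real.log ‖G c‖ := by
    have h := Real.log_le_log (Real.exp_pos _) hlow
    rwa [Real.log_exp] at h
  have hlogc' : Real.log ‖G c‖ ≤ A := by
    have h := Real.log_le_log hGc' (hup c hc)
    rwa [Real.log_exp] at h
  have hgre : ∀ z ∈ ball (0 : ℂ) r, (g z).re = Real.log ‖G (c + z)‖ - Real.log ‖G c‖ := by
    intro z hz
    have h1 : Real.log ‖Complex.exp (g z)‖ = (g z).re := by rw [Complex.norm_exp, Real.log_exp]
    rw [← h1, hexp z hz, hW_def, norm_div,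
      Real.log_div (norm_ne_zero_iff.2 (hG0 _ (hsh z hz))) hGc'.ne']
  have hre : ∀ z ∈ ball (0 : ℂ) r, (g z).re ≤ 2 * A + 1 := by
    intro z hz
    rw [hgre z hz]
    have h1 : Real.log ‖G (c + z)‖ ≤ A := by
      have h := Real.log_le_log (norm_pos_iff.2 (hG0 _ (hsh z hz))) (hup _ (hsh z hz))
      rwa [Real.log_exp] at h
    linarith
  have hη : (0 : ℝ) < 2 * A + 1 := by linarith
  have h0 : ‖g 0‖ ≤ 2 * A + 1 := by rw [hg0, norm_zero]; exact hη.le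
  -- Borel–Carathéodory on the half ball
  intro z hz
  have hzc : ‖z - c‖ < r / 2 := mem_ball_iff_norm.1 hz
  have hur : z - c ∈ ball (0 : ℂ) r := mem_ball_zero_iff.2 (by linarith)
  have hBC := norm_le_of_re_le_of_norm_zero_le (R := r) (r := r / 2) (by positivity) (by linarith) hη hgd
    hre h0 hzc.le
  have h5 : (2 * A + 1) * ((r + 3 * (r / 2)) / (r - r / 2)) = 5 * (2 * A + 1) := by
    field_simp
    ring
  rw [h5] at hBC
  have hre_u := hgre (z - c) hur
  rw [add_sub_cancel] at hre_u
  have hkey : Real.log ‖G z‖ = (g (z - c)).re + Real.log ‖G c‖ := by linarith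
  rw [hkey]
  calc |(g (z - c)).re + Real.log ‖G c‖| ≤ |(g (z - c)).re| + |Real.log ‖G c‖| := abs_add_le _ _
    _ ≤ ‖g (z - c)‖ + A := add_le_add (Complex.abs_re_le_norm _) (abs_le.2 ⟨by linarith, hlogc'⟩)
    _ ≤ 5 * (2 * A + 1) + A := by linarith
    _ = 11 * A + 5 := by ring

/-- **One function: envelope + floor at the centre ⇒ zero-free two-sided window.**  If `G` is holomorphic on
`ball c δ` with `‖G‖ ≤ e^A` there (`A ≥ 0`) and `‖G c‖ ≥ e^{−A}`, then on `ball c (δ e^{−2A}/8)`: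
`G z ≠ 0` and `|log ‖G z‖| ≤ 11 A + 5`.  (Schwarz lemma at a putative zero for zero-freeness on
`ball c (δ e^{−2A}/4)`, then `abs_log_norm_le_of_norm_le_of_ne_zero`.) [folklore] -/
theorem ne_zero_and_abs_log_norm_le_of_envelope {G : ℂ → ℂ} {c : ℂ} {δ A : ℝ} (hδ : 0 < δ) (hA : 0 ≤ A)
    (hG : DifferentiableOn ℂ G (ball c δ)) (hup : ∀ z ∈ ball c δ, ‖G z‖ ≤ Real.exp A)
    (hlow : Real.exp (-A) ≤ ‖G c‖) :
    ∀ z ∈ ball c (δ * Real.exp (-A) ^ 2 / 8), G z ≠ 0 ∧ |Real.log ‖G z‖| ≤ 11 * A + 5 := by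
  set e : ℝ := Real.exp (-A) with he_def
  have he0 : 0 < e := Real.exp_pos _
  have he1 : e ≤ 1 := Real.exp_le_one_iff.2 (neg_nonpos.2 hA)
  have hEe : Real.exp A * e = 1 := by rw [he_def, ← Real.exp_add, add_neg_cancel, Real.exp_zero]
  have he2 : e ^ 2 ≤ 1 := pow_le_one₀ he0.le he1
  set r : ℝ := δ * e ^ 2 / 4 with hr_def
  have hr0 : 0 < r := by positivity
  have hrδ : r ≤ δ / 4 := by rw [hr_def]; nlinarith
  -- (1) zero-free on `ball c r`
  have hG0 : ∀ w ∈ ball c r, G w ≠ 0 := by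
    intro w hw hGw
    have hwc : dist w c < δ / 4 := lt_of_lt_of_le (mem_ball.1 hw) hrδ
    have h1 := norm_center_le_of_eq_zero hG hup hwc hGw
    have h2 : dist c w < r := by rw [dist_comm]; exact mem_ball.1 hw
    have h3 : Real.exp A / (δ / 2) * dist c w < Real.exp A / (δ / 2) * r :=
      mul_lt_mul_of_pos_left h2 (by positivity)
    have h4 : Real.exp A / (δ / 2) * r = Real.exp A * e * e / 2 := by
      rw [hr_def]
      field_simp
      ring
    rw [hEe, one_mul] at h4
    linarith
  -- (2) two-sided bound on `ball c (r / 2)`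
  have hb := abs_log_norm_le_of_norm_le_of_ne_zero hr0 hA (hG.mono (ball_subset_ball (by linarith))) hG0
    (fun w hw => hup w (ball_subset_ball (by linarith) hw)) hlow
  intro z hz
  have hz' : z ∈ ball c (r / 2) := by
    have : r / 2 = δ * e ^ 2 / 8 := by rw [hr_def]; ring
    rwa [this]
  exact ⟨hG0 z (ball_subset_ball (by linarith) hz'), hb z hz'⟩

/-- **LOCAL CONVERTER — floor at the centre + envelope on a ball ⇒ zero-free two-sided window on a smaller
ball.**  Let `Z P` be holomorphic on `ball t δ` (`t` real), `f` holomorphic there, and for `P ≥ P₀`: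
`Z P t ≠ 0` with the FLOOR `log ‖Z P t‖ + P⁴ Re f t ≥ −M` at the centre, and the ENVELOPE
`‖Z P z · exp (P⁴ f z)‖ ≤ e^M` on the ball.  Then for some `0 < δ' ≤ δ` and `M'`, for all `P ≥ P₀` and
`z ∈ ball t δ'`: `Z P z ≠ 0` and `|log ‖Z P z‖ + P⁴ Re f z| ≤ M'`.  Proof: with `A := max M 0`,
`G_P := Z P · exp (P⁴ f)` is holomorphic with `‖G_P‖ ≤ e^A` on the ball and `‖G_P t‖ ≥ e^{−A}`; apply
`ne_zero_and_abs_log_norm_le_of_envelope` (Schwarz lemma for zero-freeness on `ball t (δ e^{−2A}/4)`, then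
Borel–Carathéodory for the holomorphic logarithm of `G_P (t + ·)/G_P t`), with `δ' := δ e^{−2A}/8`,
`M' := 11 A + 5`, and `log ‖G_P z‖ = log ‖Z P z‖ + P⁴ Re f z`. [folklore] -/
theorem stub_localWindowOfEnvelope :
    ∀ (Z : ℕ → ℂ → ℂ) (t δ M : ℝ) (P₀ : ℕ), 0 < δ →
      (∀ P : ℕ, DifferentiableOn ℂ (Z P) (Metric.ball (t : ℂ) δ)) →
      ∀ f : ℂ → ℂ, DifferentiableOn ℂ f (Metric.ball (t : ℂ) δ) →
      (∀ P : ℕ, P₀ ≤ P → Z P (t : ℂ) ≠ 0 ∧ -M ≤ Real.log ‖Z P (t : ℂ)‖ + (P : ℝ) ^ 4 * (f (t : ℂ)).re) →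
      (∀ P : ℕ, P₀ ≤ P → ∀ z ∈ Metric.ball (t : ℂ) δ,
        ‖Z P z * Complex.exp ((P : ℂ) ^ 4 * f z)‖ ≤ Real.exp M) →
      ∃ δ' : ℝ, 0 < δ' ∧ δ' ≤ δ ∧ ∃ M' : ℝ, ∀ P : ℕ, P₀ ≤ P → ∀ z ∈ Metric.ball (t : ℂ) δ',
        Z P z ≠ 0 ∧ |Real.log ‖Z P z‖ + (P : ℝ) ^ 4 * (f z).re| ≤ M' := by
  intro Z t δ M P₀ hδ hZ f hf hfloor henv
  -- WLOG `0 ≤ M`: replace `M` by `A := max M 0`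
  set A : ℝ := max M 0 with hA_def
  have hA0 : 0 ≤ A := le_max_right _ _
  have hMA : M ≤ A := le_max_left _ _
  have he2 : Real.exp (-A) ^ 2 ≤ 1 :=
    pow_le_one₀ (Real.exp_pos _).le (Real.exp_le_one_iff.2 (neg_nonpos.2 hA0))
  refine ⟨δ * Real.exp (-A) ^ 2 / 8, by positivity, by nlinarith, 11 * A + 5, ?_⟩
  intro P hP z hz
  obtain ⟨hne, hfl⟩ := hfloor P hP
  -- `G_P := Z P · exp (P⁴ f)`: holomorphic, envelope `≤ e^A`, floor `≥ e^{-A}` at the centre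
  have hGd : DifferentiableOn ℂ (fun z => Z P z * Complex.exp ((P : ℂ) ^ 4 * f z)) (ball (t : ℂ) δ) :=
    (hZ P).mul (((differentiableOn_const _).mul hf).cexp)
  have hup : ∀ z ∈ ball (t : ℂ) δ, ‖Z P z * Complex.exp ((P : ℂ) ^ 4 * f z)‖ ≤ Real.exp A :=
    fun z hz => (henv P hP z hz).trans (Real.exp_le_exp.2 hMA)
  have hlow : Real.exp (-A) ≤ ‖Z P (t : ℂ) * Complex.exp ((P : ℂ) ^ 4 * f (t : ℂ))‖ := by
    rw [norm_mul_cexp_pow_four_mul_eq hne]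
    exact Real.exp_le_exp.2 (by linarith)
  have hres : Z P z * Complex.exp ((P : ℂ) ^ 4 * f z) ≠ 0 ∧
      |Real.log ‖Z P z * Complex.exp ((P : ℂ) ^ 4 * f z)‖| ≤ 11 * A + 5 :=
    ne_zero_and_abs_log_norm_le_of_envelope hδ hA0 hGd hup hlow z hz
  obtain ⟨hGz, habs⟩ := hres
  have hZz : Z P z ≠ 0 := fun h => hGz (by rw [h, zero_mul])
  refine ⟨hZz, ?_⟩
  rwa [norm_mul_cexp_pow_four_mul_eq hZz, Real.log_exp] at habs

end Summit.QuantumFields.YangMills.Theorems.FreeEnergyWindowChannel
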